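import Summits.NavierStokesRegularity.NavierStokesRegularity.Theses.FlatSwirlGauge
import Literature.Analysis.FluidPDE.FlatSwirlGaugeChart
import HarnessLib.Audit

/-!
# Birth skeleton (BC3) of the crux `FlatSwirlGauge.FlatGaugeAtSingularity`

(crux item `stmt-NavierStokesRegularity-1252`, rank 2, route `route-NavierStokesRegularity-FlatSwirlGauge`;
tree path `Cruxes/FlatGaugeAtSingularity/Lines/birth.lean`; registrar
`planner-skel-stmt-NavierStokesRegularity-1252-0`, 2026-08-17. The route predates the Lean birth certificate;
this file supplies BC3 retroactively. No `Disproof.lean`, no crux ideas and no other lines exist for this crux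
at registration time; `ledger negatives --problem NavierStokesRegularity` (4 statements) has nothing about
first integrals / Clebsch charts / swirl gauges.)

THE CRUX (`Summit.NavierStokesRegularity.NavierStokesRegularity.Theses.FlatSwirlGauge.FlatGaugeAtSingularity`,
"FG"): `ν > 0`, `(u, p)` classical Navier–Stokes on `ℝ³ × [0, T)`, Leray–Hopf from a rapidly decaying datum;
if `u` is unbounded on EVERY backward cylinder at `(T, x₀)` then some `Q_ρ(T, x₀)` carries a FLAT SWIRL GAUGE
`(α, b, d, C₀, M)` — the inline v0 block, which is `Literature.Analysis.FluidPDE.HasFlatSwirlGauge ν u T x₀`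
letter for letter (`hasFlatSwirlGauge_iff` is `Iff.rfl`; definition file LANDED, grounder g19-21).

THE CUT — the route header's own foreseen layer-2 split of FG ("existence of a first integral near a
singularity" + "flatness of its transport defect"), typed so that the two halves are CONSISTENT and the seam is
LOSSLESS:

* vocabulary (plain `def`s over tree declarations): `IsVortexChartOn u T x₀ ρ C₀ M α d` = the clauses of
  `IsFlatSwirlGaugeOn` that do not mention the drift `b` (KINEMATIC VORTEX CHART: `α ∈ C²(Q)`, `|α| ≤ M`,
  `⟪curl u, ∇α⟫ = 0`, chart nondegeneracy `‖curl u‖ d ≤ C₀ ‖∇α‖` where `d > 0`, axis-like degeneracy set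
  `vol({d < δ} ∩ B_ρ) ≤ C₀ δ² ρ`); `transportDefect ν u α t x = ∂ₜα + (u·∇)α − νΔα`;
  `HasDriftSizeDefectOn ν u T x₀ ρ C₁ α d` = `|transportDefect| · d ≤ ν C₁ ‖∇α‖` where `d > 0` (the transport
  defect is OF DRIFT SIZE — this is "flatness" with the auxiliary unknown `b` ELIMINATED); `driftOf ν u α` = the
  canonical drift `(f / (ν‖∇α‖²)) ∇α`.
* `stub_vortexChartAtSingularity` [K, kinematic, XL, OPEN]: under FG's hypotheses, at a singular point there is a
  kinematic vortex chart on some backward cylinder. This is the INTEGRABILITY half: a bounded `C²` first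
  integral of the vortex-line field on a FIXED cylinder up to the singular time, nondegenerate off an axis-like
  thin set. Why it might fail = the crux's own: chaotic (ABC-type) vortex lines admit no first integral
  (DombreEtAl1986, ArnoldKhesin1998 Ch. II); strictly WEAKER than FG's conclusion (`isVortexChartOn_of_gauge`).
* `stub_driftSizeRegauge` [D, dynamic, XL, OPEN]: under FG's hypotheses, at a singular point that admits SOME
  kinematic vortex chart there is a (possibly different: RE-GAUGED) kinematic vortex chart whose transport
  defect is of drift size. This is the FLATNESS half (Constantin2001's diffusive Weber–Clebsch connection /
  Sato2021 §4 eq. (DO) reduced to a pure axis-type drift). It is deliberately EXISTENTIAL in the chart: the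
  universal version "every vortex chart has drift-size defect" is FALSE as soon as one chart exists — relabel
  `α ↦ α + ε sin(ψ(t)) g(α)` with `ψ′(t) → ∞` as `t ↑ T` (still a bounded `C²` first integral with the same `d`,
  but `|∂ₜα′| d / ‖∇α′‖` unbounded) — so the gauge freedom `α ↦ Φ(t, α, β)` must be spent, not quantified over.
  Why it might fail: the bracket connection (DO) is nonlocal along vortex lines; two functional degrees of
  freedom (`Φ(α, β)`) may not solve the flatness system with the `1/d` bound at a genuinely 3-D singularity.
* `FlatGaugeAtSingularity_of : Sig.stub_vortexChartAtSingularity → Sig.stub_driftSizeRegauge →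
  FlatGaugeAtSingularity` is the REAL composition (hypothesis heads carry the registered stub names; no
  placeholder outside the stubs): K gives a chart, D re-gauges it to drift-size defect, and the drift is then
  CONSTRUCTED, `b := driftOf ν u α`, and the two drift clauses of the gauge VERIFIED
  (`IsVortexChartOn.isFlatSwirlGaugeOn_driftOf`: where `∇α ≠ 0`, `⟪b, ∇α⟫ = f/ν` and `‖b‖ d = |f| d/(ν‖∇α‖) ≤ C₁`;
  where `∇α = 0`, `b = 0` and the defect bound forces `f = 0`; gauge constant `max C₀ C₁`), then
  `hasFlatSwirlGauge_iff`. `FlatGaugeAtSingularity_proof : FlatGaugeAtSingularity` is the skeleton in its final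
  shape (depends on `sorryAx` through the two stubs only).
* LOSSLESS SEAM (proved here, sorry-free): a flat swirl gauge is a vortex chart with drift-size defect
  (`isVortexChartOn_of_gauge`, `hasDriftSizeDefectOn_of_gauge`, Cauchy–Schwarz), hence
  `hasFlatSwirlGauge_iff_chart_and_defect` (`0 < ν`): FG's conclusion ⟺ (∃ vortex chart with drift-size
  defect); at the level of the stub STATEMENTS, `sig_stub_vortexChartAtSingularity_of_crux : FG → K` and
  `sig_stub_driftSizeRegauge_of_crux : FG → D`, so with the composition the cut is EXACT, `FG ⟺ K ∧ D`: K is a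
  NECESSARY condition for FG and D is FG's exact residue given K — nothing is hidden in an unnamed step, and
  neither stub alone is the crux or the summit (BC3 probes below).

RESHAPE LOG (lead c1, 2026-08-17): vocabulary + seam moved to the tree
(`Literature/Analysis/FluidPDE/FlatSwirlGaugeChart.lean`, p147813, accepted); kinematic obstruction to K landed
separately (`Theorems/FlatGaugeAtSingularity/Negative/FlatGaugeAtSingularityFalseOfDenseVortexLines.lean`:
one vortex line dense in an open sub-ball at one time slice kills every chart on the cylinder). Stubs unchanged.

EXACTLY-FLAT MODEL (anchor, landed): axisymmetric `u`, `α = Γ = r u_θ`, `d = r`, `b = −(2/r) e_r`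
(`IsClassicalNSSolutionOn.isFlatSwirlGaugeOn_swirl`, KNSS2009 (1.8) = `swirl_transport_holds`): there K is the
poloidal-dominance bound `‖ω‖ r ≤ C₀ ‖∇Γ‖` plus `|Γ| ≤ M` (swirl maximum principle) and D holds with `C₁ = 2`
(`|f| r = ν |(2/r)∂ᵣΓ| r ≤ 2ν‖∇Γ‖`).

BC3 AUDIT (this seat; raw outputs in the seat's NOTES.md `birth-certificate:`): `lean check --json` rc 0 with
`sorry` exactly in `stub_vortexChartAtSingularity`, `stub_driftSizeRegauge` (sorry count 2 = stub count, zero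
elsewhere); probes `stub → FlatGaugeAtSingularity` and `stub → NavierStokesRegularity` by
`first | exact? | simpa [stub] | (unfold stub; simpa) | aesop` FAIL for both stubs (4/4), files
`bc/probe_*.lean` of the seat folder.
-/

set_option linter.unusedVariables false
set_option linter.dupNamespace false

noncomputable section

open Set MeasureTheory Metric Function
open scoped RealInnerProductSpace ENNReal Topology
open Literature.Analysis.FluidPDE
open Summit.NavierStokesRegularity.NavierStokesRegularity.Theses.FlatSwirlGauge

namespace Summit.NavierStokesRegularity.NavierStokesRegularity.Cruxes.FlatGaugeAtSingularity.Birth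

/-- Local notation for physical space `ℝ³ = EuclideanSpace ℝ (Fin 3)`. -/
local notation "ℝ³" => EuclideanSpace ℝ (Fin 3)

/-! ### Vocabulary (LANDED, lead c1, p147813): `Literature/Analysis/FluidPDE/FlatSwirlGaugeChart.lean` —
`IsVortexChartOn`, `transportDefect`, `HasDriftSizeDefectOn`, `driftOf`, the seam lemmas
`isVortexChartOn_of_gauge`, `hasDriftSizeDefectOn_of_gauge`, `IsVortexChartOn.isFlatSwirlGaugeOn_driftOf`
and the lossless seam `hasFlatSwirlGauge_iff_chart_and_defect` are imported from the tree (namespace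
`Literature.Analysis.FluidPDE`, opened above); the stub signatures below are textually unchanged. -/

/-! ### Stub signatures (`Sig.stub_*`: the hypothesis heads of `FlatGaugeAtSingularity_of` carry the
registered stub names; each `stub_*` theorem below restates its `Sig` verbatim) -/

/-- STUB 1 (K) — **KINEMATIC VORTEX CHART AT A SINGULARITY** (open, XL; the integrability half). `ν > 0`,
`(u, p)` classical NS on `ℝ³ × [0, T)`, Leray–Hopf from a rapidly decaying datum; if `u` is unbounded on every
backward cylinder at `(T, x₀)`, then some `Q_ρ(T, x₀)` carries a kinematic vortex chart `(α, d, C₀, M)`: a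
bounded `C²` first integral of the vorticity, nondegenerate (`‖ω‖ d ≤ C₀‖∇α‖`) off an axis-like thin set.
Why it might fail: chaotic (ABC-type) vortex-line geometry admits no first integral on a fixed cylinder up to
`T` (DombreEtAl1986; ArnoldKhesin1998 Ch. II); the thinness clause ties the degeneracy set to one scale `ρ`.
Sources: Constantin2001 (short-time diffusive Weber–Clebsch charts with resetting), Ohkitani2018,
Hou2022PotentiallySingularNS (test: `r|ω_θ| ≲ |∇Γ|` on the high-|ω| set). -/
def Sig.stub_vortexChartAtSingularity : Prop :=
  ∀ (ν T : ℝ), 0 < ν → 0 < T →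
    ∀ (u : ℝ → ℝ³ → ℝ³) (p : ℝ → ℝ³ → ℝ),
      IsClassicalNSSolutionOn (Set.Ico 0 T) ν 0 u p → IsLerayHopfOn T ν 0 (u 0) u →
      HasRapidSpatialDecay (u 0) →
      ∀ x₀ : ℝ³, ¬ (∃ r : ℝ, 0 < r ∧ ∃ K : ℝ, ∀ t ∈ Set.Ioo (T - r ^ 2) T, 0 ≤ t →
          ∀ x ∈ Metric.ball x₀ r, ‖u t x‖ ≤ K) →
        ∃ (ρ C₀ M : ℝ) (α : ℝ → ℝ³ → ℝ) (d : ℝ → ℝ³ → ℝ), IsVortexChartOn u T x₀ ρ C₀ M α d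

/-- STUB 2 (D) — **RE-GAUGING TO DRIFT-SIZE DEFECT** (open, XL; the flatness half). Same class of solutions and
the same singular point; if SOME kinematic vortex chart exists on a backward cylinder at `(T, x₀)`, then there is
a (possibly different — re-gauged, `α ↦ Φ(t, α, β)`, smaller cylinder, larger constants) kinematic vortex chart
whose transport defect is of drift size: `|∂ₜα + (u·∇)α − νΔα| d ≤ ν C₁ ‖∇α‖` off the degeneracy set, `C₁ ≥ 0`.
Deliberately existential in the chart (the universal version is false by time-dependent relabelling, see the
module docstring). Exactly-flat model: `α = Γ`, `C₁ = 2`. Why it might fail: the viscous Clebsch connection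
(Sato2021 §4 eq. (DO)) is nonlocal along vortex lines and the two functional degrees of freedom `Φ(α, β)` may
not flatten it with the `1/d` bound at a genuinely three-dimensional singularity. Sources: Constantin2001,
Sato2021 §4, KNSS2009 (1.8) (`swirl_transport_holds`). -/
def Sig.stub_driftSizeRegauge : Prop :=
  ∀ (ν T : ℝ), 0 < ν → 0 < T →
    ∀ (u : ℝ → ℝ³ → ℝ³) (p : ℝ → ℝ³ → ℝ),
      IsClassicalNSSolutionOn (Set.Ico 0 T) ν 0 u p → IsLerayHopfOn T ν 0 (u 0) u →
      HasRapidSpatialDecay (u 0) →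
      ∀ x₀ : ℝ³, ¬ (∃ r : ℝ, 0 < r ∧ ∃ K : ℝ, ∀ t ∈ Set.Ioo (T - r ^ 2) T, 0 ≤ t →
          ∀ x ∈ Metric.ball x₀ r, ‖u t x‖ ≤ K) →
        (∃ (ρ C₀ M : ℝ) (α : ℝ → ℝ³ → ℝ) (d : ℝ → ℝ³ → ℝ), IsVortexChartOn u T x₀ ρ C₀ M α d) →
        ∃ (ρ C₀ M C₁ : ℝ) (α : ℝ → ℝ³ → ℝ) (d : ℝ → ℝ³ → ℝ),
          IsVortexChartOn u T x₀ ρ C₀ M α d ∧ 0 ≤ C₁ ∧ HasDriftSizeDefectOn ν u T x₀ ρ C₁ α d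

/-! ### Registered stubs -/

/-- Registered stub 1 (K — kinematic vortex chart at a singularity; statement = `Sig.stub_vortexChartAtSingularity`
verbatim). -/
theorem stub_vortexChartAtSingularity :
    ∀ (ν T : ℝ), 0 < ν → 0 < T →
    ∀ (u : ℝ → ℝ³ → ℝ³) (p : ℝ → ℝ³ → ℝ),
      IsClassicalNSSolutionOn (Set.Ico 0 T) ν 0 u p → IsLerayHopfOn T ν 0 (u 0) u →
      HasRapidSpatialDecay (u 0) →
      ∀ x₀ : ℝ³, ¬ (∃ r : ℝ, 0 < r ∧ ∃ K : ℝ, ∀ t ∈ Set.Ioo (T - r ^ 2) T, 0 ≤ t →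
          ∀ x ∈ Metric.ball x₀ r, ‖u t x‖ ≤ K) →
        ∃ (ρ C₀ M : ℝ) (α : ℝ → ℝ³ → ℝ) (d : ℝ → ℝ³ → ℝ), IsVortexChartOn u T x₀ ρ C₀ M α d := by
  sorry

/-- Registered stub 2 (D — re-gauging to drift-size defect; statement = `Sig.stub_driftSizeRegauge` verbatim). -/
theorem stub_driftSizeRegauge :
    ∀ (ν T : ℝ), 0 < ν → 0 < T →
    ∀ (u : ℝ → ℝ³ → ℝ³) (p : ℝ → ℝ³ → ℝ),
      IsClassicalNSSolutionOn (Set.Ico 0 T) ν 0 u p → IsLerayHopfOn T ν 0 (u 0) u →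
      HasRapidSpatialDecay (u 0) →
      ∀ x₀ : ℝ³, ¬ (∃ r : ℝ, 0 < r ∧ ∃ K : ℝ, ∀ t ∈ Set.Ioo (T - r ^ 2) T, 0 ≤ t →
          ∀ x ∈ Metric.ball x₀ r, ‖u t x‖ ≤ K) →
        (∃ (ρ C₀ M : ℝ) (α : ℝ → ℝ³ → ℝ) (d : ℝ → ℝ³ → ℝ), IsVortexChartOn u T x₀ ρ C₀ M α d) →
        ∃ (ρ C₀ M C₁ : ℝ) (α : ℝ → ℝ³ → ℝ) (d : ℝ → ℝ³ → ℝ),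
          IsVortexChartOn u T x₀ ρ C₀ M α d ∧ 0 ≤ C₁ ∧ HasDriftSizeDefectOn ν u T x₀ ρ C₁ α d := by
  sorry

/-! ### Composition -/

/-- **The line closes the crux BY NAME modulo the two registered stubs** (closed: the stub statements enter as
hypotheses, no placeholder here). From K take a kinematic vortex chart at the singular point; D re-gauges it to
one with drift-size defect `(C₁ ≥ 0)`; the drift `b := driftOf ν u α` then completes it to a flat swirl gauge
with constant `max C₀ C₁` (`IsVortexChartOn.isFlatSwirlGaugeOn_driftOf` — the actual verification of the two
drift clauses), and `hasFlatSwirlGauge_iff` (`Iff.rfl`) identifies that with the crux's inline conclusion. -/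
theorem FlatGaugeAtSingularity_of :
    Sig.stub_vortexChartAtSingularity → Sig.stub_driftSizeRegauge → FlatGaugeAtSingularity := by
  intro hK hD ν T hν hT u p hcl hLH hdec x₀ hsing
  obtain ⟨ρ, C₀, M, C₁, α, d, hchart, hC₁, hdef⟩ :=
    hD ν T hν hT u p hcl hLH hdec x₀ hsing (hK ν T hν hT u p hcl hLH hdec x₀ hsing)
  exact (hasFlatSwirlGauge_iff ν u T x₀).1
    (hchart.isFlatSwirlGaugeOn_driftOf hν hC₁ hdef).hasFlatSwirlGauge

/-- The skeleton in its final shape (D-0027 §3.3): the crux BY NAME from the two registered stubs; it becomes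
the crux proof when the last `stub_*` is discharged (until then it depends on `sorryAx` through the stubs
only — no `sorry` of its own). -/
theorem FlatGaugeAtSingularity_proof : FlatGaugeAtSingularity :=
  FlatGaugeAtSingularity_of stub_vortexChartAtSingularity stub_driftSizeRegauge

/-! ### The cut is exact: the crux gives both stub statements back (sorry-free) -/

/-- K is NECESSARY: the crux implies the statement of `stub_vortexChartAtSingularity` (drop the drift clauses of
the gauge it provides, `isVortexChartOn_of_gauge`). With `FlatGaugeAtSingularity_of` this shows the cut is an
exact decomposition `FG ⟺ K ∧ D`, not a weakening. -/
theorem sig_stub_vortexChartAtSingularity_of_crux :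
    FlatGaugeAtSingularity → Sig.stub_vortexChartAtSingularity := by
  intro hFG ν T hν hT u p hcl hLH hdec x₀ hsing
  obtain ⟨ρ, C₀, M, α, b, d, hg⟩ := (hasFlatSwirlGauge_iff ν u T x₀).2 (hFG ν T hν hT u p hcl hLH hdec x₀ hsing)
  exact ⟨ρ, C₀, M, α, d, isVortexChartOn_of_gauge hg⟩

/-- D is NECESSARY: the crux implies the statement of `stub_driftSizeRegauge` (a gauge is a chart with
drift-size defect, `hasDriftSizeDefectOn_of_gauge`, constant `C₁ := C₀ ≥ 0`). -/
theorem sig_stub_driftSizeRegauge_of_crux :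
    FlatGaugeAtSingularity → Sig.stub_driftSizeRegauge := by
  intro hFG ν T hν hT u p hcl hLH hdec x₀ hsing _
  obtain ⟨ρ, C₀, M, α, b, d, hg⟩ := (hasFlatSwirlGauge_iff ν u T x₀).2 (hFG ν T hν hT u p hcl hLH hdec x₀ hsing)
  exact ⟨ρ, C₀, M, C₀, α, d, isVortexChartOn_of_gauge hg, hg.const_nonneg,
    hasDriftSizeDefectOn_of_gauge hν.le hg⟩

end Summit.NavierStokesRegularity.NavierStokesRegularity.Cruxes.FlatGaugeAtSingularity.Birth

end
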